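import Mathlib
import Summits.NavierStokesRegularity.NavierStokesRegularity.Theorems.WakeRatchetTailRatchetRelayFixedPoint
import Summits.NavierStokesRegularity.NavierStokesRegularity.Theorems.WakeRatchetTailRatchetRelayBorderedGeneral
import HarnessLib

/-!
# `WakeRatchet.TailRatchet` (stmt-NavierStokesRegularity-21808): EXISTENCE OF THE LACUNARY FRONT — the
# Picard sequence converges to a solution of the scalar front equation with a second-order drain law

Support file for the crux `TailRatchet` (route `WakeRatchet`; MODEL lattice ODEs of Tao 2016 §1.2, §4 —
nothing in this file is a statement about the Navier–Stokes equations, and no item is closed here).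

Context (programme "R-lac" of the census of stmt-21808, ASSEMBLY, step 3/3): the Picard sequence of
`…RelayFixedPoint` converges (weighted-uniformly, together with its derivatives) on `t ≤ 0`; the limit
`(h, δ)` solves the drain-bordered fixed-point problem, hence (`…RelayNonlinearMap.front_iff_bordered`)
`b = e^{t} + h` solves the SCALAR FRONT EQUATION
`b'(t) = (4/s²) b(t/s)² − 4sδ · b(t) b(st)`  (`t < 0`)
at every time ratio `s ∈ [2 − 10⁻²⁶, 2]`, with `|h| ≤ 8Kη e^{t/2}`, `|δ| ≤ 8Kη`, `h(0) = 0`, and the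
SECOND-ORDER DRAIN LAW `|δ − ε₁(s)| ≤ 10²²η²`, `ε₁(s) = (∫w₁·(−Res_s))/(∫w₁·8e^{3t})` the linear response
(`η = 2 − s`, `K = 1100000`):

* `relay_front_exists`.

With `δ > 0` (the sign of `ε₁`, companion file `…RelayLinearResponse`) the rescaling `a = (4/Λ) b`,
`Λ = δ^{-1/2}`, is an exact scalar dyadic DSS front in the sense of `WakeRatchetDyadicFront.DyadicScalarFronts`
at ONE (large) `ε₀ = Λ^{2/5} − 1` — see `…LacunaryFront`.

HONEST FRAMING: MODEL lattice only; lacunary fronts (LARGE `ε₀`) do NOT refute `TailRatchet` (which needs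
`Λ → 1`); the construction item and the crux stay open.
-/

noncomputable section

set_option linter.dupNamespace false

namespace Summit.NavierStokesRegularity.NavierStokesRegularity.Theorems

namespace WakeRatchetRelayFront

open Set Filter Topology MeasureTheory
open WakeRatchetRelayNonlinearMap WakeRatchetRelayInverseBound WakeRatchetRelayBorderedGeneral
  WakeRatchetRelayNonlinearEstimates WakeRatchetRelayContraction WakeRatchetRelayFixedPoint

/-- **EXISTENCE OF THE LACUNARY FRONT (fixed point of the Picard map).**  For every time ratio
`s ∈ [2 − 10⁻²⁶, 2]`, `η = 2 − s`, there are `δ ∈ ℝ` and `h : ℝ → ℝ`, continuous on `(−∞,0]`, `h(0) = 0`,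
`|h(t)| ≤ 8800000·η·e^{t/2}`, `|δ| ≤ 8800000·η`, such that `b = e^{t} + h` solves the scalar front equation
`b'(t) = (4/s²)b(t/s)² − 4sδ·b(t)b(st)` on `t < 0`, and `δ` obeys the second-order drain law
`|δ − (∫_{(−∞,0]} w₁·(−(e^{t} − (4/s²)e^{2t/s}))) / (∫_{(−∞,0]} w₁·8e^{3t})| ≤ 10²²η²`
(`w₁` the adjoint mode of `…RelayAdjoint`).
[cite: Tao2016AveragedNS, §1.2 (dyadic model); cell vocabulary (scalar front equation of `DyadicScalarFronts`; programme R-lac of the census of stmt-21808, assembly)] -/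
theorem relay_front_exists {s : ℝ} (hs1 : 2 - 1 / 10 ^ 26 ≤ s) (hs2 : s ≤ 2) :
    ∃ δ : ℝ, ∃ h : ℝ → ℝ,
      ContinuousOn h (Iic 0) ∧ h 0 = 0 ∧
      (∀ t : ℝ, t ≤ 0 → |h t| ≤ 8800000 * (2 - s) * Real.exp (t / 2)) ∧
      |δ| ≤ 8800000 * (2 - s) ∧
      (∀ t : ℝ, t < 0 → HasDerivAt (fun x => Real.exp x + h x)
        (4 / s ^ 2 * (Real.exp (t / s) + h (t / s)) ^ 2
          - 4 * s * δ * ((Real.exp t + h t) * (Real.exp (s * t) + h (s * t)))) t) ∧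
      |δ - (∫ t in Iic (0 : ℝ), (∑' m : ℕ, (∏ i ∈ Finset.range m, ((-4 : ℝ) / (2 ^ (i + 1) - 1))) *
              Real.exp ((2 ^ m - 1) * t)) * (-(Real.exp t - 4 / s ^ 2 * Real.exp (2 * t / s)))) /
          (∫ t in Iic (0 : ℝ), (∑' m : ℕ, (∏ i ∈ Finset.range m, ((-4 : ℝ) / (2 ^ (i + 1) - 1))) *
              Real.exp ((2 ^ m - 1) * t)) * (8 * Real.exp (3 * t)))| ≤ 10 ^ 22 * (2 - s) ^ 2 := by
  -- constants
  set η : ℝ := 2 - s with hη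
  have hη0 : 0 ≤ η := by rw [hη]; linarith
  have hη1 : η ≤ 1 / 10 ^ 26 := by rw [hη]; linarith
  have hs32 : (3 : ℝ) / 2 ≤ s := by
    have : (1 : ℝ) / 10 ^ 26 ≤ 1 / 2 := by norm_num
    linarith
  have hs0 : 0 < s := by linarith
  set r : ℝ := 8800000 * η with hr
  have hr0 : 0 ≤ r := by rw [hr]; positivity
  set κ : ℝ := 1100000 * (22 * η + 36 * r + 32 * r ^ 2) with hκ
  have hκ0 : 0 ≤ κ := by rw [hκ]; positivity
  have hκhalf : κ ≤ 1 / 2 := by rw [hκ, hr]; exact contraction_ineq hη0 hη1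
  have hκ1 : κ < 1 := by linarith
  have h1κ : 1 / (1 - κ) ≤ 2 := by rw [div_le_iff₀ (by linarith)]; linarith
  -- the Picard sequence
  obtain ⟨hs, hs', ds, hc, h0, hl, hd, hρ, hD, hδ, hs00, hds0, hRel, hΔ, hΔ', hΔδ⟩ :=
    picard_sequence hs1 hs2
  -- consecutive distances
  have hu : ∀ t : ℝ, t ≤ 0 → ∀ n, dist (hs n t) (hs (n + 1) t) ≤ r * Real.exp (t / 2) * κ ^ n := by
    intro t ht n
    rw [dist_comm, Real.dist_eq]
    have := hΔ n t ht
    simp only [← hη, ← hr, ← hκ] at this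
    linarith
  have hu' : ∀ t : ℝ, t < 0 → ∀ n, dist (hs' n t) (hs' (n + 1) t) ≤ r * Real.exp (t / 2) * κ ^ n := by
    intro t ht n
    rw [dist_comm, Real.dist_eq]
    have := hΔ' n t ht
    simp only [← hη, ← hr, ← hκ] at this
    linarith
  have huδ : ∀ n, dist (ds n) (ds (n + 1)) ≤ r * κ ^ n := by
    intro n
    rw [dist_comm, Real.dist_eq]
    have := hΔδ n
    simp only [← hη, ← hr, ← hκ] at this
    exact this
  -- pointwise limits
  set h : ℝ → ℝ := fun t => limUnder atTop (fun n => hs n t) with hhdef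
  set G : ℝ → ℝ := fun t => limUnder atTop (fun n => hs' n t) with hGdef
  set δ : ℝ := limUnder atTop ds with hδdef
  have hlim : ∀ t : ℝ, t ≤ 0 → Tendsto (fun n => hs n t) atTop (𝓝 (h t)) := fun t ht =>
    tendsto_nhds_limUnder (cauchySeq_tendsto_of_complete (cauchySeq_of_le_geometric κ _ hκ1 (hu t ht)))
  have hlimG : ∀ t : ℝ, t < 0 → Tendsto (fun n => hs' n t) atTop (𝓝 (G t)) := fun t ht =>
    tendsto_nhds_limUnder (cauchySeq_tendsto_of_complete (cauchySeq_of_le_geometric κ _ hκ1 (hu' t ht)))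
  have hlimδ : Tendsto ds atTop (𝓝 δ) :=
    tendsto_nhds_limUnder (cauchySeq_tendsto_of_complete (cauchySeq_of_le_geometric κ _ hκ1 huδ))
  -- rates
  have hrate : ∀ t : ℝ, t ≤ 0 → ∀ n, dist (hs n t) (h t) ≤ 2 * r * κ ^ n := by
    intro t ht n
    have h1 := dist_le_of_le_geometric_of_tendsto κ _ hκ1 (hu t ht) (hlim t ht) n
    have he : Real.exp (t / 2) ≤ 1 := Real.exp_le_one_iff.2 (by linarith)
    have hκn : 0 ≤ κ ^ n := pow_nonneg hκ0 n
    calc dist (hs n t) (h t) ≤ r * Real.exp (t / 2) * κ ^ n / (1 - κ) := h1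
      _ = r * Real.exp (t / 2) * κ ^ n * (1 / (1 - κ)) := by ring
      _ ≤ r * 1 * κ ^ n * 2 := by gcongr
      _ = 2 * r * κ ^ n := by ring
  have hrate' : ∀ t : ℝ, t < 0 → ∀ n, dist (hs' n t) (G t) ≤ 2 * r * κ ^ n := by
    intro t ht n
    have h1 := dist_le_of_le_geometric_of_tendsto κ _ hκ1 (hu' t ht) (hlimG t ht) n
    have he : Real.exp (t / 2) ≤ 1 := Real.exp_le_one_iff.2 (by linarith)
    have hκn : 0 ≤ κ ^ n := pow_nonneg hκ0 n
    calc dist (hs' n t) (G t) ≤ r * Real.exp (t / 2) * κ ^ n / (1 - κ) := h1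
      _ = r * Real.exp (t / 2) * κ ^ n * (1 / (1 - κ)) := by ring
      _ ≤ r * 1 * κ ^ n * 2 := by gcongr
      _ = 2 * r * κ ^ n := by ring
  have hrateδ : dist (ds 1) δ ≤ 2 * r * κ := by
    have h1 := dist_le_of_le_geometric_of_tendsto κ _ hκ1 huδ hlimδ 1
    calc dist (ds 1) δ ≤ r * κ ^ 1 / (1 - κ) := h1
      _ = r * κ * (1 / (1 - κ)) := by ring
      _ ≤ r * κ * 2 := by gcongr
      _ = 2 * r * κ := by ring
  -- the geometric rate tends to zero
  have hgeo : Tendsto (fun n : ℕ => 2 * r * κ ^ n) atTop (𝓝 0) := by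
    have := (tendsto_pow_atTop_nhds_zero_of_lt_one hκ0 hκ1).const_mul (2 * r)
    rwa [mul_zero] at this
  -- uniform convergence on the half-lines
  have hunif : TendstoUniformlyOn (fun n => hs n) h atTop (Iic 0) := by
    refine Metric.tendstoUniformlyOn_iff.2 fun ε hε => ?_
    filter_upwards [hgeo.eventually (gt_mem_nhds hε)] with n hn t ht
    rw [dist_comm]
    exact (hrate t ht n).trans_lt hn
  have hunif' : TendstoUniformlyOn (fun n => hs' n) G atTop (Iio 0) := by
    refine Metric.tendstoUniformlyOn_iff.2 fun ε hε => ?_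
    filter_upwards [hgeo.eventually (gt_mem_nhds hε)] with n hn t ht
    rw [dist_comm]
    exact (hrate' t ht n).trans_lt hn
  -- continuity, normalisation, bounds of the limit
  have hcont : ContinuousOn h (Iic 0) :=
    hunif.continuousOn (Eventually.of_forall fun n => (hc n).continuousOn).frequently
  have hh0 : h 0 = 0 := by
    have h1 : Tendsto (fun n => hs n 0) atTop (𝓝 0) := by
      simp only [h0]; exact tendsto_const_nhds
    exact tendsto_nhds_unique (hlim 0 le_rfl) h1
  have hhρ : ∀ t : ℝ, t ≤ 0 → |h t| ≤ r * Real.exp (t / 2) := fun t ht =>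
    le_of_tendsto' ((hlim t ht).abs) fun n => by
      have := hρ n t ht; simp only [← hη, ← hr] at this; exact this
  have hδr : |δ| ≤ r :=
    le_of_tendsto' hlimδ.abs fun n => by have := hδ n; simp only [← hη, ← hr] at this; exact this
  -- the limit is differentiable with derivative `G`
  have hder : ∀ t : ℝ, t < 0 → HasDerivAt h (G t) t := fun t ht =>
    hasDerivAt_of_tendstoUniformlyOn isOpen_Iio hunif'
      (Eventually.of_forall fun n x hx => hd n x hx) (fun x hx => hlim x (le_of_lt hx)) ht
  -- identification of `G`
  have hGeq : ∀ t : ℝ, t < 0 → G t = 2 * Real.exp (t / 2) * h (t / 2) +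
      (((-(Real.exp t - 4 / s ^ 2 * Real.exp (2 * t / s)) -
          (2 * Real.exp (t / 2) * h (t / 2) - 8 / s ^ 2 * Real.exp (t / s) * h (t / s)) +
          4 / s ^ 2 * h (t / s) ^ 2 -
          δ * (4 * s * ((Real.exp t + h t) * (Real.exp (s * t) + h (s * t))) - 8 * Real.exp (3 * t))))
        - δ * (8 * Real.exp (3 * t))) := by
    intro t ht
    have ht2 : t / 2 ≤ 0 := by linarith
    have hts : t / s ≤ 0 := div_nonpos_of_nonpos_of_nonneg ht.le hs0.le
    have hst : s * t ≤ 0 := mul_nonpos_of_nonneg_of_nonpos hs0.le ht.le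
    -- the shifted derivative sequence tends to `G t`
    have hA : Tendsto (fun n => hs' (n + 1) t) atTop (𝓝 (G t)) :=
      (hlimG t ht).comp (tendsto_add_atTop_nat 1)
    -- and to the right-hand side, by continuity of the algebraic expression
    have hΦ : Continuous (fun p : ℝ × ℝ × ℝ × ℝ × ℝ × ℝ × ℝ =>
        2 * Real.exp (t / 2) * p.1 +
          (((-(Real.exp t - 4 / s ^ 2 * Real.exp (2 * t / s)) -
              (2 * Real.exp (t / 2) * p.2.1 - 8 / s ^ 2 * Real.exp (t / s) * p.2.2.1) +
              4 / s ^ 2 * p.2.2.1 ^ 2 -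
              p.2.2.2.1 * (4 * s * ((Real.exp t + p.2.2.2.2.1) * (Real.exp (s * t) + p.2.2.2.2.2.1)) -
                8 * Real.exp (3 * t))))
            - p.2.2.2.2.2.2 * (8 * Real.exp (3 * t)))) := by fun_prop
    have hv : Tendsto (fun n => (hs (n + 1) (t / 2), hs n (t / 2), hs n (t / s), ds n, hs n t,
        hs n (s * t), ds (n + 1))) atTop
        (𝓝 (h (t / 2), h (t / 2), h (t / s), δ, h t, h (s * t), δ)) :=
      ((hlim _ ht2).comp (tendsto_add_atTop_nat 1)).prodMk_nhds ((hlim _ ht2).prodMk_nhds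
        ((hlim _ hts).prodMk_nhds (hlimδ.prodMk_nhds ((hlim _ ht.le).prodMk_nhds
          ((hlim _ hst).prodMk_nhds (hlimδ.comp (tendsto_add_atTop_nat 1)))))))
    have hB := (hΦ.tendsto _).comp hv
    have hfun : (fun n => hs' (n + 1) t) = (fun p : ℝ × ℝ × ℝ × ℝ × ℝ × ℝ × ℝ =>
        2 * Real.exp (t / 2) * p.1 +
          (((-(Real.exp t - 4 / s ^ 2 * Real.exp (2 * t / s)) -
              (2 * Real.exp (t / 2) * p.2.1 - 8 / s ^ 2 * Real.exp (t / s) * p.2.2.1) +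
              4 / s ^ 2 * p.2.2.1 ^ 2 -
              p.2.2.2.1 * (4 * s * ((Real.exp t + p.2.2.2.2.1) * (Real.exp (s * t) + p.2.2.2.2.2.1)) -
                8 * Real.exp (3 * t))))
            - p.2.2.2.2.2.2 * (8 * Real.exp (3 * t)))) ∘
        (fun n => (hs (n + 1) (t / 2), hs n (t / 2), hs n (t / s), ds n, hs n t,
          hs n (s * t), ds (n + 1))) := by
      funext n
      simp only [Function.comp]
      exact hRel n t
    rw [hfun] at hA
    exact tendsto_nhds_unique hA hB
  -- the front equation
  have hfront : ∀ t : ℝ, t < 0 → HasDerivAt (fun x => Real.exp x + h x)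
      (4 / s ^ 2 * (Real.exp (t / s) + h (t / s)) ^ 2
        - 4 * s * δ * ((Real.exp t + h t) * (Real.exp (s * t) + h (s * t)))) t := by
    intro t ht
    have h1 := ((Real.hasDerivAt_exp t).add (hder t ht))
    refine h1.congr_deriv ?_
    rw [hGeq t ht, ← front_iff_bordered (s := s) (δ := δ) (h := h) t]
    ring
  -- the first iterate: `δ₁ = ε₁(s)` by uniqueness of the drain-bordered problem
  have hε₁ : ds 1 = (∫ t in Iic (0 : ℝ), (∑' m : ℕ, (∏ i ∈ Finset.range m,
        ((-4 : ℝ) / (2 ^ (i + 1) - 1))) * Real.exp ((2 ^ m - 1) * t)) *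
          (-(Real.exp t - 4 / s ^ 2 * Real.exp (2 * t / s)))) /
      (∫ t in Iic (0 : ℝ), (∑' m : ℕ, (∏ i ∈ Finset.range m, ((-4 : ℝ) / (2 ^ (i + 1) - 1))) *
          Real.exp ((2 ^ m - 1) * t)) * (8 * Real.exp (3 * t))) := by
    -- the residual forcing
    have hfc : Continuous (fun t : ℝ => -(Real.exp t - 4 / s ^ 2 * Real.exp (2 * t / s))) := by
      fun_prop
    have hfA : ∀ t : ℝ, t ≤ 0 → |(-(Real.exp t - 4 / s ^ 2 * Real.exp (2 * t / s)))| ≤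
        4 * |s - 2| * Real.exp (t / 2) := fun t ht => by
      rw [abs_neg]; exact residual_abs_le hs32 hs2 ht
    have hfB : ∀ t : ℝ, t ≤ 0 → |(-(Real.exp t - 4 / s ^ 2 * Real.exp (2 * t / s)))| ≤ 4 * |s - 2| :=
      fun t ht => (hfA t ht).trans (by
        have : Real.exp (t / 2) ≤ 1 := Real.exp_le_one_iff.2 (by linarith)
        have : 0 ≤ 4 * |s - 2| := by positivity
        nlinarith)
    obtain ⟨hfi, -⟩ := weighted_integrable hfc hfA
    obtain ⟨ε', g', hε', hgc', hg0', hgd', ⟨B', hB'⟩, hgl'⟩ := drain_bordered_exists hfc hfB hfi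
    -- the first iterate solves the same problem
    have hlaw1 : ∀ t : ℝ, t < 0 → HasDerivAt (hs 1)
        (2 * Real.exp (t / 2) * hs 1 (t / 2) +
          ((-(Real.exp t - 4 / s ^ 2 * Real.exp (2 * t / s))) - ds 1 * (8 * Real.exp (3 * t)))) t := by
      intro t ht
      have := hd 1 t ht
      rw [hRel 0 t] at this
      refine this.congr_deriv ?_
      simp only [hs00, hds0]
      ring
    have hB1 : ∀ t : ℝ, t ≤ 0 → |hs 1 t| ≤ r := fun t ht => by
      have h1 := hρ 1 t ht
      simp only [← hη, ← hr] at h1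
      exact h1.trans (by
        have : Real.exp (t / 2) ≤ 1 := Real.exp_le_one_iff.2 (by linarith)
        nlinarith)
    obtain ⟨heq, -⟩ := drain_bordered_unique (hc 1).continuousOn hgc'.continuousOn hlaw1 hgd' hB1 hB'
      (h0 1) hg0' (hl 1) hgl'
    rw [heq, hε']
  -- second-order drain law
  have hsecond : |δ - ds 1| ≤ 10 ^ 22 * η ^ 2 := by
    rw [← Real.dist_eq, dist_comm]
    refine hrateδ.trans ?_
    rw [hr, hκ]
    exact second_order_ineq hη1
  refine ⟨δ, h, hcont, hh0, fun t ht => ?_, ?_, hfront, ?_⟩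
  · have := hhρ t ht; rwa [hr] at this
  · rwa [hr] at hδr
  · rw [← hε₁]; exact hsecond

end WakeRatchetRelayFront

end Summit.NavierStokesRegularity.NavierStokesRegularity.Theorems

end
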